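import Summits.CriticalPhenomena.SAWScalingLimit.Theses.SAWTrackTransport

/-!
# Line `birth` — registered skeleton for the crux `MirrorRotation` (stmt-CriticalPhenomena-16997)

Crux (FIXED; rank 7 of `route-CriticalPhenomena-SAWTrackTransport`): THE REFLECTION TRICK
(DKKMO2020Rotational §7.1, case `Ω = ℝ²`, transposed to chordal curve families) —
`AngleUniversality → (endpoint approximations at every angle α ∈ [π/3, 2π/3]) → ∀ P chordal,
RL(π/2) P → P is covariant under every rotation z ↦ c z, ‖c‖ = 1`, where `RL α P` is the route's
robust-full-limit predicate (for every Dobrushin domain `D`, every family of sub-mesh translates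
`D + u_δ`, `‖u_δ‖ ≤ δ`, and every admissible family of mid-edge endpoints, the critical Yang–Baxter
law at constant angle `α`, pushed to `CurveClass ℂ`, converges in law to `P D`).

## The cut (three stubs; the route header's own proof plan, one stub per kind of mathematics)

Write `m_α : z ↦ e^{iα} z̄` for the mirror across the line `e^{iα/2} ℝ` through the origin and
`m_{α,δ} : z ↦ e^{iα} z̄ − (iδ/2)(1 + e^{iα})` for the mirror across the parallel line through `−iδ/2`
(`‖m_{α,δ} − m_α‖ = δ cos(α/2) ≤ δ`). The rescaled rhombic tiling `δ·(−i/2 + ℤ i + ℤ(sin α − i cos α))`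
of constant angle `α` is mapped onto itself by `m_{α,δ}` (it swaps the two unit generators `i` and
`−i e^{iα}`: face `(k, j) ↦ (j, k)`, `vert k j ↦ slant j k`, `slant k j ↦ vert j k`, arc kinds
corner/coCorner/straight preserved, hence `localWeight`, `weight`, `length`, `meshFaces` preserved).

* T  `stub_mirrorTransport` (COMBINATORIAL; size M–L) — EXACT LATTICE MIRROR EQUIVARIANCE OF THE
  FINITE-VOLUME CURVE LAW: for `α ∈ [π/3, 2π/3]` there is a relabelling `E : MidEdge → MidEdge` with
  `planeMidpoint α (E e) = m_{α,1} (planeMidpoint α e)` such that for all `Ω, δ > 0, a, b` the walk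
  spaces `YangBaxterSAW α Ω δ a b` and `YangBaxterSAW α (m_{α,δ} Ω) δ (E a) (E b)` are simultaneously
  (non)empty and the curve law of the second is the push-forward of the curve law of the first along
  `CurveClass.map m_{α,δ}` (junk values included: total weights agree under the bijection).
* M  `stub_mirrorPassage` (WEAK CONVERGENCE; size M) — MIRROR EQUIVARIANCE PASSES TO THE ROBUST
  LIMIT: for `α ∈ [π/3, 2π/3]`, T's conclusion + `P` chordal + endpoint approximations at angle `α` +
  `RL α P` give `P (m_α D) = (m_α)_* (P D)` for every Dobrushin domain `D`. Route: apply `RL α P` at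
  `m_α D` (zero shift) and at `D` with the pulled-back endpoints and the shift
  `u_δ = −(iδ/2)(1 + e^{iα})` (`m_{α,δ} ∘ m_α = · + u_δ`, `‖u_δ‖ ≤ δ` — this is what the robustness in
  `RL` is for), compare the two along T's identity, replace `m_{α,δ}` by `m_α` at uniform cost `≤ δ`
  (converging-together, `tendstoLaw_of_dist_le`), push along the continuous `CurveClass.map m_α`
  (`TendstoLaw.comp_continuous`) and conclude by uniqueness of limits in law of finite Borel measures
  (`map_eq_map_of_tendstoLaw` / `ext_of_forall_integral_eq_of_IsFiniteMeasure`; `P D` is a probability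
  measure by `IsChordal`).
* R  `stub_rotationOfMirrors` (GROUP THEORY + FUNCTORIALITY; size M) — MIRRORS AT ALL ANGLES OF AN
  INTERVAL GENERATE ALL ROTATIONS: covariance of `P` under `m_α` for every `α ∈ [π/3, 2π/3]` gives
  covariance under every rotation `z ↦ c z`, `‖c‖ = 1`: `m_α ∘ m_β = (z ↦ e^{i(α−β)} z)`, covariances
  compose (`ChordalFamily.covariant_trans`, `MarkedDomain.map_map`, `CurveClass.map_homeomorph_trans`),
  `α − β` sweeps `[−π/3, π/3]`, and `c = e^{iθ}`, `|θ| ≤ π`, is the cube of the rotation by `θ/3`,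
  `|θ/3| ≤ π/3` (no closure argument).

`MirrorRotation_of` (kernel-checked, no `sorry` of its own): given `AU`, `EP`, `P` chordal and
`RL(π/2) P`, for each `α ∈ [π/3, 2π/3]` `AU` gives `RL α P`, `EP α` the endpoint approximations, T the
lattice transport, M the `m_α`-covariance; R turns the family of mirror covariances into rotation
covariance. Hypotheses = the three stubs under their registered names (`__Registered.stub_…`);
conclusion = the route decl `Summit.CriticalPhenomena.SAWScalingLimit.Theses.SAWTrackTransport.MirrorRotation`
BY NAME.

Disproof used: none relevant — no `Disproof.lean` / `_false_without_` theorem exists for this crux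
(`ledger crux ls stmt-CriticalPhenomena-16997`: no workfiles before this one, 2026-08-17). Negatives index
(`ledger negatives --problem CriticalPhenomena`) has no statement about mirror / rotation covariance of
Yang–Baxter limits; the refuted all-`δ` tightness stmt-0772 is not used (everything is eventual in `δ`).
Conjugation covariance (exact for the square tiling) is NOT needed and not stubbed: rotations come from
pairs of mirrors inside `[π/3, 2π/3]` alone.
-/

noncomputable section

open MeasureTheory Filter Topology
open Literature.Probability.RandomPlanarGeometry
open Literature.Probability.RandomPlanarGeometry.SAW.YangBaxter

namespace Summit.CriticalPhenomena.SAWScalingLimit.Cruxes.MirrorRotation.Birth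

/-! ### Vocabulary of the line -/

/-- The route's robust-full-limit predicate `RL α P` (verbatim the `let RL := …` of the route file
`Theses/SAWTrackTransport.lean`): the critical constant-angle-`α` Yang–Baxter curve law of every
sub-mesh translate `D + u_δ` (`‖u_δ‖ ≤ δ`) with admissible mid-edge endpoints converges in law to `P D`. -/
def RL (α : ℝ) (P : ChordalFamily) : Prop :=
  ∀ (D : DobrushinDomain) (u : ℝ → ℂ) (a b : ℝ → MidEdge), (∀ᶠ δ in 𝓝[>] (0 : ℝ), ‖u δ‖ ≤ δ) →
    (∀ᶠ δ in 𝓝[>] (0 : ℝ), Nonempty (YangBaxterSAW (fun (_ : ℤ) => α)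
      ((D.map (similarity 1 one_ne_zero (u δ))).carrier) δ (a δ) (b δ))) →
    Tendsto (fun δ : ℝ => (δ : ℂ) * planeMidpoint (fun (_ : ℤ) => α) (a δ)) (𝓝[>] (0 : ℝ))
      (𝓝 (D.pt 0)) →
    Tendsto (fun δ : ℝ => (δ : ℂ) * planeMidpoint (fun (_ : ℤ) => α) (b δ)) (𝓝[>] (0 : ℝ))
      (𝓝 (D.pt 1)) →
    TendstoLaw (fun δ (γ : YangBaxterSAW (fun (_ : ℤ) => α)
        ((D.map (similarity 1 one_ne_zero (u δ))).carrier) δ (a δ) (b δ)) =>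
        γ.curve (fun (_ : ℤ) => α) δ)
      (fun δ => ybLaw (fun (_ : ℤ) => α) ((D.map (similarity 1 one_ne_zero (u δ))).carrier) δ 1
        (a δ) (b δ)) id (P D)

/-- The mirror `m_α : z ↦ e^{iα} z̄` across the line `e^{iα/2} ℝ` through the origin (conjugate,
then rotate by `α`), as a plane homeomorphism. -/
abbrev mirror (α : ℝ) : ℂ ≃ₜ ℂ :=
  Complex.conjLIE.toHomeomorph.trans
    (similarity (Complex.exp ((α : ℂ) * Complex.I)) (Complex.exp_ne_zero _) 0)

/-- The lattice mirror `m_{α,δ} : z ↦ e^{iα} z̄ − (iδ/2)(1 + e^{iα})` across the parallel line through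
`−iδ/2`: the exact symmetry of the rescaled constant-angle-`α` rhombic tiling at mesh `δ`. -/
abbrev latticeMirror (α δ : ℝ) : ℂ ≃ₜ ℂ :=
  Complex.conjLIE.toHomeomorph.trans
    (similarity (Complex.exp ((α : ℂ) * Complex.I)) (Complex.exp_ne_zero _)
      (-((δ : ℂ) * Complex.I * (1 + Complex.exp ((α : ℂ) * Complex.I)) / 2)))

/-- Covariance of the chordal family `P` under the mirror `m_α`. -/
def MirrorCovariant (α : ℝ) (P : ChordalFamily) : Prop :=
  ∀ D : DobrushinDomain, P (D.map (mirror α)) = (P D).map (CurveClass.map (mirror α : C(ℂ, ℂ)))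

/-- **T, named.** Exact lattice mirror equivariance of the finite-volume Yang–Baxter curve law at
constant angle `α`. -/
def MirrorTransport (α : ℝ) : Prop :=
  ∃ E : MidEdge → MidEdge,
    (∀ e : MidEdge, planeMidpoint (fun (_ : ℤ) => α) (E e) =
      latticeMirror α 1 (planeMidpoint (fun (_ : ℤ) => α) e)) ∧
    ∀ (Ω : Set ℂ) (δ : ℝ) (a b : MidEdge), 0 < δ →
      (Nonempty (YangBaxterSAW (fun (_ : ℤ) => α) Ω δ a b) ↔
        Nonempty (YangBaxterSAW (fun (_ : ℤ) => α) (latticeMirror α δ '' Ω) δ (E a) (E b))) ∧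
      (ybLaw (fun (_ : ℤ) => α) (latticeMirror α δ '' Ω) δ 1 (E a) (E b)).map
          (fun γ : YangBaxterSAW (fun (_ : ℤ) => α) (latticeMirror α δ '' Ω) δ (E a) (E b) =>
            γ.curve (fun (_ : ℤ) => α) δ) =
        ((ybLaw (fun (_ : ℤ) => α) Ω δ 1 a b).map
          (fun γ : YangBaxterSAW (fun (_ : ℤ) => α) Ω δ a b => γ.curve (fun (_ : ℤ) => α) δ)).map
          (CurveClass.map (latticeMirror α δ : C(ℂ, ℂ)))

/-- **M, named.** Mirror equivariance passes to the robust full limit at angle `α`. -/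
def MirrorPassage : Prop :=
  ∀ α ∈ Set.Icc (Real.pi / 3) (2 * Real.pi / 3), MirrorTransport α →
    ∀ P : ChordalFamily, P.IsChordal →
      (∀ D : DobrushinDomain, ∃ a b : ℝ → MidEdge, IsYBEndpointApprox (fun (_ : ℤ) => α) D a b) →
      RL α P → MirrorCovariant α P

/-- **R, named.** Mirror covariance at every angle of `[π/3, 2π/3]` gives covariance under every
rotation about the origin. -/
def RotationOfMirrors : Prop :=
  ∀ P : ChordalFamily, (∀ α ∈ Set.Icc (Real.pi / 3) (2 * Real.pi / 3), MirrorCovariant α P) →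
    ∀ (D : DobrushinDomain) (c : ℂ) (hc : c ≠ 0), ‖c‖ = 1 →
      P (D.map (similarity c hc 0)) = (P D).map (CurveClass.map (similarity c hc 0 : C(ℂ, ℂ)))

/-! ### The stubs (the ONLY `sorry`s of this file)

Each stub is stated over TREE VOCABULARY ONLY (the named statements above unfolded by hand, the
mirrors written as `Complex.conjLIE.toHomeomorph.trans (similarity (cexp (α I)) _ w)` exactly as in
`LatticeSimilarityCovariance.lean`), so that it lands verbatim as a
`Theorems/SAWTrackTransportMirrorRotation<Stub>.lean --supports stmt-CriticalPhenomena-16997` file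
without importing this workfile; the `*_holds` theorems below certify definitionally that the
unfolded text IS the named statement. -/

/-- **T — exact lattice mirror equivariance of the finite-volume curve law.** For every
`α ∈ [π/3, 2π/3]` there is a relabelling of mid-edges `E` (in fact `vert k j ↦ slant j k`,
`slant k j ↦ vert j k`) intertwining the embeddings through the scale-`1` lattice mirror, such that
for every domain `Ω`, mesh `δ > 0` and mid-edges `a, b`: walks of `Ω_δ` from `a` to `b` exist iff
walks of `(m_{α,δ} Ω)_δ` from `E a` to `E b` exist, and the critical Yang–Baxter law of the latter,
pushed to curves, is the push-forward along `CurveClass.map m_{α,δ}` of the former pushed to curves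
(face swap `(k, j) ↦ (j, k)` preserves arc kinds, `localWeight`, `weight`, `length`, `meshFaces`; the
polyline through mirrored midpoints is the mirrored polyline). -/
theorem stub_mirrorTransport :
    ∀ α ∈ Set.Icc (Real.pi / 3) (2 * Real.pi / 3), ∃ E : MidEdge → MidEdge,
      (∀ e : MidEdge, planeMidpoint (fun (_ : ℤ) => α) (E e) =
        (Complex.conjLIE.toHomeomorph.trans
          (similarity (Complex.exp ((α : ℂ) * Complex.I)) (Complex.exp_ne_zero _)
            (-(((1 : ℝ) : ℂ) * Complex.I * (1 + Complex.exp ((α : ℂ) * Complex.I)) / 2))))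
          (planeMidpoint (fun (_ : ℤ) => α) e)) ∧
      ∀ (Ω : Set ℂ) (δ : ℝ) (a b : MidEdge), 0 < δ →
        (Nonempty (YangBaxterSAW (fun (_ : ℤ) => α) Ω δ a b) ↔
          Nonempty (YangBaxterSAW (fun (_ : ℤ) => α)
            ((Complex.conjLIE.toHomeomorph.trans
              (similarity (Complex.exp ((α : ℂ) * Complex.I)) (Complex.exp_ne_zero _)
                (-((δ : ℂ) * Complex.I * (1 + Complex.exp ((α : ℂ) * Complex.I)) / 2)))) '' Ω)
            δ (E a) (E b))) ∧
        (ybLaw (fun (_ : ℤ) => α)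
            ((Complex.conjLIE.toHomeomorph.trans
              (similarity (Complex.exp ((α : ℂ) * Complex.I)) (Complex.exp_ne_zero _)
                (-((δ : ℂ) * Complex.I * (1 + Complex.exp ((α : ℂ) * Complex.I)) / 2)))) '' Ω)
            δ 1 (E a) (E b)).map
            (fun γ : YangBaxterSAW (fun (_ : ℤ) => α)
              ((Complex.conjLIE.toHomeomorph.trans
                (similarity (Complex.exp ((α : ℂ) * Complex.I)) (Complex.exp_ne_zero _)
                  (-((δ : ℂ) * Complex.I * (1 + Complex.exp ((α : ℂ) * Complex.I)) / 2)))) '' Ω)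
              δ (E a) (E b) => γ.curve (fun (_ : ℤ) => α) δ) =
          ((ybLaw (fun (_ : ℤ) => α) Ω δ 1 a b).map
            (fun γ : YangBaxterSAW (fun (_ : ℤ) => α) Ω δ a b => γ.curve (fun (_ : ℤ) => α) δ)).map
            (CurveClass.map
              ((Complex.conjLIE.toHomeomorph.trans
                (similarity (Complex.exp ((α : ℂ) * Complex.I)) (Complex.exp_ne_zero _)
                  (-((δ : ℂ) * Complex.I * (1 + Complex.exp ((α : ℂ) * Complex.I)) / 2))) : ℂ ≃ₜ ℂ) :
                C(ℂ, ℂ))) := by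
  sorry

/-- **M — mirror equivariance passes to the robust full limit.** For `α ∈ [π/3, 2π/3]`, given the
lattice transport T at `α`, a chordal family `P` with endpoint approximations at angle `α` in every
Dobrushin domain and with `RL α P` is covariant under the mirror `m_α : z ↦ e^{iα} z̄`. Apply `RL α P`
at `m_α D` (zero shift) and at `D` (pulled-back endpoints, shift `u_δ = −(iδ/2)(1 + e^{iα})`,
`‖u_δ‖ = δ cos(α/2) ≤ δ`, `m_{α,δ} ∘ m_α = · + u_δ`), compare along T, replace `m_{α,δ}` by `m_α` at
uniform cost `≤ δ` (converging together), push along `CurveClass.map m_α` and use uniqueness of limits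
in law (`P D`, `P (m_α D)` are probability measures). -/
theorem stub_mirrorPassage :
    let RL : ℝ → ChordalFamily → Prop := fun α P => ∀ (D : DobrushinDomain) (u : ℝ → ℂ)
      (a b : ℝ → MidEdge), (∀ᶠ δ in 𝓝[>] (0 : ℝ), ‖u δ‖ ≤ δ) →
      (∀ᶠ δ in 𝓝[>] (0 : ℝ), Nonempty (YangBaxterSAW (fun (_ : ℤ) => α)
        ((D.map (similarity 1 one_ne_zero (u δ))).carrier) δ (a δ) (b δ))) →
      Tendsto (fun δ : ℝ => (δ : ℂ) * planeMidpoint (fun (_ : ℤ) => α) (a δ)) (𝓝[>] (0 : ℝ))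
        (𝓝 (D.pt 0)) →
      Tendsto (fun δ : ℝ => (δ : ℂ) * planeMidpoint (fun (_ : ℤ) => α) (b δ)) (𝓝[>] (0 : ℝ))
        (𝓝 (D.pt 1)) →
      TendstoLaw (fun δ (γ : YangBaxterSAW (fun (_ : ℤ) => α)
          ((D.map (similarity 1 one_ne_zero (u δ))).carrier) δ (a δ) (b δ)) =>
          γ.curve (fun (_ : ℤ) => α) δ)
        (fun δ => ybLaw (fun (_ : ℤ) => α) ((D.map (similarity 1 one_ne_zero (u δ))).carrier) δ 1
          (a δ) (b δ)) id (P D);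
    ∀ α ∈ Set.Icc (Real.pi / 3) (2 * Real.pi / 3),
      (∃ E : MidEdge → MidEdge,
        (∀ e : MidEdge, planeMidpoint (fun (_ : ℤ) => α) (E e) =
          (Complex.conjLIE.toHomeomorph.trans
            (similarity (Complex.exp ((α : ℂ) * Complex.I)) (Complex.exp_ne_zero _)
              (-(((1 : ℝ) : ℂ) * Complex.I * (1 + Complex.exp ((α : ℂ) * Complex.I)) / 2))))
            (planeMidpoint (fun (_ : ℤ) => α) e)) ∧
        ∀ (Ω : Set ℂ) (δ : ℝ) (a b : MidEdge), 0 < δ →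
          (Nonempty (YangBaxterSAW (fun (_ : ℤ) => α) Ω δ a b) ↔
            Nonempty (YangBaxterSAW (fun (_ : ℤ) => α)
              ((Complex.conjLIE.toHomeomorph.trans
                (similarity (Complex.exp ((α : ℂ) * Complex.I)) (Complex.exp_ne_zero _)
                  (-((δ : ℂ) * Complex.I * (1 + Complex.exp ((α : ℂ) * Complex.I)) / 2)))) '' Ω)
              δ (E a) (E b))) ∧
          (ybLaw (fun (_ : ℤ) => α)
              ((Complex.conjLIE.toHomeomorph.trans
                (similarity (Complex.exp ((α : ℂ) * Complex.I)) (Complex.exp_ne_zero _)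
                  (-((δ : ℂ) * Complex.I * (1 + Complex.exp ((α : ℂ) * Complex.I)) / 2)))) '' Ω)
              δ 1 (E a) (E b)).map
              (fun γ : YangBaxterSAW (fun (_ : ℤ) => α)
                ((Complex.conjLIE.toHomeomorph.trans
                  (similarity (Complex.exp ((α : ℂ) * Complex.I)) (Complex.exp_ne_zero _)
                    (-((δ : ℂ) * Complex.I * (1 + Complex.exp ((α : ℂ) * Complex.I)) / 2)))) '' Ω)
                δ (E a) (E b) => γ.curve (fun (_ : ℤ) => α) δ) =
            ((ybLaw (fun (_ : ℤ) => α) Ω δ 1 a b).map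
              (fun γ : YangBaxterSAW (fun (_ : ℤ) => α) Ω δ a b =>
                γ.curve (fun (_ : ℤ) => α) δ)).map
              (CurveClass.map
                ((Complex.conjLIE.toHomeomorph.trans
                  (similarity (Complex.exp ((α : ℂ) * Complex.I)) (Complex.exp_ne_zero _)
                    (-((δ : ℂ) * Complex.I * (1 + Complex.exp ((α : ℂ) * Complex.I)) / 2))) : ℂ ≃ₜ ℂ) :
                  C(ℂ, ℂ)))) →
      ∀ P : ChordalFamily, P.IsChordal →
        (∀ D : DobrushinDomain, ∃ a b : ℝ → MidEdge, IsYBEndpointApprox (fun (_ : ℤ) => α) D a b) →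
        RL α P →
        ∀ D : DobrushinDomain,
          P (D.map (Complex.conjLIE.toHomeomorph.trans
              (similarity (Complex.exp ((α : ℂ) * Complex.I)) (Complex.exp_ne_zero _) 0))) =
            (P D).map (CurveClass.map
              ((Complex.conjLIE.toHomeomorph.trans
                (similarity (Complex.exp ((α : ℂ) * Complex.I)) (Complex.exp_ne_zero _) 0) : ℂ ≃ₜ ℂ) :
                C(ℂ, ℂ))) := by
  sorry

/-- **R — mirrors at all angles of `[π/3, 2π/3]` generate all rotations.** If the chordal family
`P` is covariant under the mirror `m_α : z ↦ e^{iα} z̄` for every `α ∈ [π/3, 2π/3]`, it is covariant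
under every rotation `z ↦ c z`, `‖c‖ = 1`: `m_α ∘ m_β` is the rotation by `α − β ∈ [−π/3, π/3]`,
covariances compose (`ChordalFamily.covariant_trans`), and the rotation by `θ ∈ (−π, π]` is the cube
of the rotation by `θ/3 = (π/2 + θ/6) − (π/2 − θ/6)`. -/
theorem stub_rotationOfMirrors :
    ∀ P : ChordalFamily,
      (∀ α ∈ Set.Icc (Real.pi / 3) (2 * Real.pi / 3), ∀ D : DobrushinDomain,
        P (D.map (Complex.conjLIE.toHomeomorph.trans
            (similarity (Complex.exp ((α : ℂ) * Complex.I)) (Complex.exp_ne_zero _) 0))) =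
          (P D).map (CurveClass.map
            ((Complex.conjLIE.toHomeomorph.trans
              (similarity (Complex.exp ((α : ℂ) * Complex.I)) (Complex.exp_ne_zero _) 0) : ℂ ≃ₜ ℂ) :
              C(ℂ, ℂ)))) →
      ∀ (D : DobrushinDomain) (c : ℂ) (hc : c ≠ 0), ‖c‖ = 1 →
        P (D.map (similarity c hc 0)) = (P D).map (CurveClass.map (similarity c hc 0 : C(ℂ, ℂ))) := by
  sorry

/-! ### Consistency: each named statement IS its registered stub (definitionally) -/

theorem mirrorTransport_holds : ∀ α ∈ Set.Icc (Real.pi / 3) (2 * Real.pi / 3), MirrorTransport α :=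
  stub_mirrorTransport
theorem mirrorPassage_holds : MirrorPassage := stub_mirrorPassage
theorem rotationOfMirrors_holds : RotationOfMirrors := stub_rotationOfMirrors

/-! ### Name-keyed aliases of the three statements — the hypotheses of `MirrorRotation_of`

The native skeleton audit (`#h21_check_skeleton`) admits a hypothesis of the skeleton theorem only if its
head constant is a registered obligation or is NAMED like a declared stub; `__Registered.stub_X` is the
statement of `stub_X` under that name (device of the sibling skeletons `Cruxes/AxiomsOfLimit/Lines/birth.lean`,
`RiemannHypothesis/…/Lines/pencil_bracket_count.lean`: the `__` namespace is an implementation detail, so the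
audit's stub report resolves each `stub_…` to the sorried theorem, not to the alias; the gate-reserved `@[stub]`
attribute is not written by a planner). Each alias is definitionally its statement. -/
namespace __Registered

/-- Alias of `∀ α ∈ [π/3, 2π/3], MirrorTransport α` keyed by the registered stub name. -/
abbrev stub_mirrorTransport : Prop := ∀ α ∈ Set.Icc (Real.pi / 3) (2 * Real.pi / 3), MirrorTransport α
/-- Alias of `MirrorPassage` keyed by the registered stub name. -/
abbrev stub_mirrorPassage : Prop := MirrorPassage
/-- Alias of `RotationOfMirrors` keyed by the registered stub name. -/
abbrev stub_rotationOfMirrors : Prop := RotationOfMirrors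

end __Registered

/-! ### The skeleton theorem: the three stubs imply the crux, BY NAME -/

/-- **`MirrorRotation` from the line `birth`** (kernel-checked, no `sorry` of its own): given angle
universality `AU`, endpoint approximations `EP` at every angle, a chordal `P` and its robust full square
limit `RL(π/2) P`, for each `α ∈ [π/3, 2π/3]` angle universality gives `RL α P`, the lattice transport T
and the passage M give covariance under the mirror `m_α`, and R composes the mirrors of the interval
into every rotation. Hypotheses = the three stubs, under their registered names; conclusion = the route
decl, by name. -/
theorem MirrorRotation_of (hT : __Registered.stub_mirrorTransport) (hM : __Registered.stub_mirrorPassage)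
    (hR : __Registered.stub_rotationOfMirrors) :
    Summit.CriticalPhenomena.SAWScalingLimit.Theses.SAWTrackTransport.MirrorRotation := by
  intro hAU hEP P hP hRL D c hc h1
  refine hR P (fun α hα => ?_) D c hc h1
  exact hM α hα (hT α hα) P hP (hEP α hα) (hAU α hα P hP hRL)

/-- Wiring check (an `example`, so that `MirrorRotation_of` stays the only theorem concluding the crux):
the registered stubs, with their tree-vocabulary types, feed the skeleton theorem as stated — this term
becomes the crux proof when the three `sorry`s above are discharged. -/
example : Summit.CriticalPhenomena.SAWScalingLimit.Theses.SAWTrackTransport.MirrorRotation :=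
  MirrorRotation_of stub_mirrorTransport stub_mirrorPassage stub_rotationOfMirrors

end Summit.CriticalPhenomena.SAWScalingLimit.Cruxes.MirrorRotation.Birth

end
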